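import Literature.Probability.RandomMatrix.TruncationHybridStep
import Literature.Probability.RandomMatrix.TruncatedHaarGinibre
import HarnessLib

/-!
# The hybrid matrices for truncations of Haar unitaries: laws and symmetry

Ingredients of the column-by-column (hybrid, Lindeberg-type) comparison between the scaled
`n × n` truncation of a Haar unitary of `U(m)` and the Ginibre ensemble:

* the columns are sampled from the tree's Ginibre ensemble `ginibre m n` (file
  `TruncatedHaarGinibre`: `n` i.i.d. standard complex Gaussian vectors of `ℂ^m`);
* `gsTruncMatrix`: the array `(i, j) ↦ √m · (gramSchmidtNormed g j)_i`, `i, j < n` (columns =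
  truncated frame vectors). It is the entrywise-conjugate transpose of the tree's `truncGS`
  (rows = conjugated frame vectors), whose law under `ginibre m n` is the truncated Haar law
  `𝒮_{m,n}` (`truncatedHaarMeasure_eq_map_truncGS`); the law of `gsTruncMatrix` is derived from that
  identity in `QuantumComplexity/HaarUnitaryTruncationTV.lean` (conjugate-transpose invariance of
  `𝒮_{m,n}`), where the target fact lives;
* `hybridMatrix k`: columns `j < k` taken from `gsTruncMatrix`, columns `j ≥ k` the raw Gaussian
  coordinates; `hybridMatrix 0` has the Ginibre law (`ginibre_map_hybridMatrix_zero`, using the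
  transposition invariance of i.i.d. arrays `pi_pi_map_transpose`) and `hybridMatrix n = gsTruncMatrix`
  (`ginibre_map_hybridMatrix_zero`, `hybridMatrix_self`);
* the symmetry estimate `integral_sum_normSqProj_le`: for any measurable, permutation-equivariant
  choice of `k` columns `cols y` out of i.i.d. Gaussian columns `y`, the expected value of
  `∑_{i<n} ‖P_{span(cols y)} e_i‖²` is at most `n k/m` (coordinate-permutation invariance and
  `∑_{a<m} ‖P_V e_a‖² = dim V ≤ k`).
-/

open MeasureTheory ProbabilityTheory WithLp Matrix InnerProductSpace Submodule Module
open scoped ENNReal NNReal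

namespace Literature.Probability.RandomMatrix

open Literature.MeasureTheory.TotalVariation
open Literature.Computability.QuantumComplexity (stdComplexGaussian gaussianMatrixMeasure)
open Literature.Analysis.InnerProduct (measurable_gramSchmidt_apply measurable_gramSchmidtNormed_apply)

variable {m n : ℕ}

/-! ### The hybrid matrices (columns sampled from `ginibre m n`) -/

/-- The scaled truncated Gram–Schmidt array: `(i, j) ↦ √m · (gramSchmidtNormed ℂ g j)_{castLE i}`.
[folklore] -/
noncomputable def gsTruncMatrix (hle : n ≤ m) (g : Fin n → EuclideanSpace ℂ (Fin m)) : Fin n → Fin n → ℂ :=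
  fun i j => (Real.sqrt m : ℂ) * (gramSchmidtNormed ℂ g j) (Fin.castLE hle i)

/-- The `k`-th hybrid array: Gram–Schmidt columns for `j < k`, raw Gaussian coordinates for
`j ≥ k`. [folklore] -/
noncomputable def hybridMatrix (hle : n ≤ m) (k : ℕ) (g : Fin n → EuclideanSpace ℂ (Fin m)) :
    Fin n → Fin n → ℂ :=
  fun i j => if (j : ℕ) < k then gsTruncMatrix hle g i j else (g j) (Fin.castLE hle i)

/-- `gsTruncMatrix` is measurable. [folklore] -/
theorem measurable_gsTruncMatrix (hle : n ≤ m) : Measurable (gsTruncMatrix (m := m) (n := n) hle) := by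
  refine measurable_pi_lambda _ fun i => measurable_pi_lambda _ fun j => ?_
  refine Measurable.mul measurable_const ?_
  exact (measurable_pi_apply (Fin.castLE hle i)).comp ((measurable_ofLp_two (Fin m)).comp
    (measurable_gramSchmidtNormed_apply ℂ j))

/-- `hybridMatrix k` is measurable. [folklore] -/
theorem measurable_hybridMatrix (hle : n ≤ m) (k : ℕ) : Measurable (hybridMatrix (m := m) (n := n) hle k) := by
  refine measurable_pi_lambda _ fun i => measurable_pi_lambda _ fun j => ?_
  by_cases h : (j : ℕ) < k
  · simp only [hybridMatrix, if_pos h]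
    exact (measurable_pi_apply j).comp ((measurable_pi_apply i).comp (measurable_gsTruncMatrix hle))
  · simp only [hybridMatrix, if_neg h]
    exact (measurable_pi_apply (Fin.castLE hle i)).comp ((measurable_ofLp_two (Fin m)).comp
      (measurable_pi_apply j))

/-- `hybridMatrix n = gsTruncMatrix` (all columns orthonormalised). [folklore] -/
theorem hybridMatrix_self (hle : n ≤ m) : hybridMatrix hle n = gsTruncMatrix (m := m) hle := by
  funext g; funext i; funext j
  simp [hybridMatrix, j.2]

/-- `hybridMatrix 0 g = (g j)_{castLE i}` (all columns raw). [folklore] -/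
theorem hybridMatrix_zero (hle : n ≤ m) (g : Fin n → EuclideanSpace ℂ (Fin m)) :
    hybridMatrix hle 0 g = fun i j => (g j) (Fin.castLE hle i) := by
  funext i; funext j
  simp [hybridMatrix]

/-! ### The law of `hybridMatrix 0` is the Ginibre law -/

/-- **Transposition invariance of i.i.d. arrays**: transposing an array of i.i.d. entries gives an
array of i.i.d. entries. [folklore] -/
theorem pi_pi_map_transpose {ι κ α : Type*} [Fintype ι] [Fintype κ] [MeasurableSpace α]
    (μ : Measure α) [IsProbabilityMeasure μ] :
    (Measure.pi fun _ : κ => Measure.pi fun _ : ι => μ).map (fun A (i : ι) (j : κ) => A j i) =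
      Measure.pi fun _ : ι => Measure.pi fun _ : κ => μ := by
  have hτ : Measurable fun (A : κ → ι → α) (i : ι) (j : κ) => A j i :=
    measurable_pi_lambda _ fun i => measurable_pi_lambda _ fun j =>
      (measurable_pi_apply i).comp (measurable_pi_apply j)
  symm
  refine Measure.pi_eq_generateFrom (C := fun _ : ι => Set.univ.pi '' Set.univ.pi fun _ : κ => {s : Set α | MeasurableSet s})
    (fun _ => generateFrom_pi) (fun _ => isPiSystem_pi) (fun _ => ?_) ?_
  · refine ⟨fun _ => Set.univ, fun _ => ?_, fun _ => ?_, ?_⟩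
    · exact ⟨fun _ => Set.univ, fun _ _ => MeasurableSet.univ, Set.pi_univ Set.univ⟩
    · exact measure_lt_top _ _
    · exact Set.iUnion_const _
  · intro s hs
    choose t htm hts using hs
    rw [Measure.map_apply hτ (MeasurableSet.univ_pi fun i => by
      rw [← hts i]; exact MeasurableSet.univ_pi fun j => htm i j (Set.mem_univ j))]
    have hpre : (fun (A : κ → ι → α) (i : ι) (j : κ) => A j i) ⁻¹' Set.univ.pi s =
        Set.univ.pi fun j => Set.univ.pi fun i => t i j := by
      ext A
      simp only [Set.mem_preimage, Set.mem_univ_pi]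
      constructor
      · intro h j i
        have := h i
        rw [← hts i, Set.mem_univ_pi] at this
        exact this j
      · intro h i
        rw [← hts i, Set.mem_univ_pi]
        exact fun j => h j i
    rw [hpre, Measure.pi_pi]
    simp_rw [Measure.pi_pi]
    rw [Finset.prod_comm]
    refine Finset.prod_congr rfl fun i _ => ?_
    rw [← hts i, Measure.pi_pi]

/-- The first `n` coordinates of `γ^m` (on the Euclidean space) form `γ^n`. [folklore] -/
theorem gaussianEuc_map_castLE (hle : n ≤ m) :
    (gaussianEuc (Fin m)).map (fun (x : EuclideanSpace ℂ (Fin m)) (i : Fin n) => x (Fin.castLE hle i)) =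
      gaussianPi (Fin n) := by
  have h1 : (fun (x : EuclideanSpace ℂ (Fin m)) (i : Fin n) => x (Fin.castLE hle i)) =
      (fun (y : Fin m → ℂ) (i : Fin n) => y (Fin.castLE hle i)) ∘ ofLp := rfl
  rw [h1, ← Measure.map_map (measurable_pi_lambda _ fun i => measurable_pi_apply _)
    (measurable_ofLp_two (Fin m)), ← gaussianPi_eq_map_ofLp, gaussianPi_map_restrict (Fin.castLE_injective hle)]

/-- **The law of `hybridMatrix 0` is the Ginibre law `𝒢^{n×n}`.** [folklore] -/
theorem ginibre_map_hybridMatrix_zero (hle : n ≤ m) :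
    (ginibre m n).map (hybridMatrix hle 0) = gaussianMatrixMeasure n := by
  have hR : Measurable fun (g : Fin n → EuclideanSpace ℂ (Fin m)) (j : Fin n) (i : Fin n) =>
      (g j) (Fin.castLE hle i) :=
    measurable_pi_lambda _ fun j => measurable_pi_lambda _ fun i =>
      (measurable_pi_apply (Fin.castLE hle i)).comp ((measurable_ofLp_two (Fin m)).comp (measurable_pi_apply j))
  have hτ : Measurable fun (A : Fin n → Fin n → ℂ) (i : Fin n) (j : Fin n) => A j i :=
    measurable_pi_lambda _ fun i => measurable_pi_lambda _ fun j =>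
      (measurable_pi_apply i).comp (measurable_pi_apply j)
  have hfact : hybridMatrix (m := m) hle 0 = (fun (A : Fin n → Fin n → ℂ) (i : Fin n) (j : Fin n) => A j i) ∘
      fun (g : Fin n → EuclideanSpace ℂ (Fin m)) (j : Fin n) (i : Fin n) => (g j) (Fin.castLE hle i) := by
    funext g; rw [hybridMatrix_zero]; rfl
  have hF : Measurable fun (x : EuclideanSpace ℂ (Fin m)) (i : Fin n) => x (Fin.castLE hle i) :=
    measurable_pi_lambda _ fun i => (measurable_pi_apply (Fin.castLE hle i)).comp (measurable_ofLp_two (Fin m))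
  have hpi : (Measure.pi fun _ : Fin n => gaussianEuc (Fin m)).map
      (fun (g : Fin n → EuclideanSpace ℂ (Fin m)) (j : Fin n) (i : Fin n) => (g j) (Fin.castLE hle i)) =
      Measure.pi fun _ : Fin n => (gaussianEuc (Fin m)).map
        (fun (x : EuclideanSpace ℂ (Fin m)) (i : Fin n) => x (Fin.castLE hle i)) := by
    exact Measure.pi_map_pi (fun _ => hF.aemeasurable)
  rw [hfact, ← Measure.map_map hτ hR, ginibre, hpi]
  simp only [gaussianEuc_map_castLE hle, gaussianPi]
  rw [pi_pi_map_transpose]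
  rfl

/-! ### The projection functional and its symmetry -/

section Proj

variable {k : ℕ}

/-- `normSqProj a v = ‖P_{span v} e_a‖²`, the squared norm of the projection of the `a`-th standard
vector onto the span of the family `v`. [folklore] -/
noncomputable def normSqProj (a : Fin m) (v : Fin k → EuclideanSpace ℂ (Fin m)) : ℝ :=
  ‖(span ℂ (Set.range v)).starProjection (EuclideanSpace.single a (1:ℂ))‖ ^ 2

/-- `0 ≤ normSqProj ≤ 1`. [folklore] -/
theorem normSqProj_nonneg (a : Fin m) (v : Fin k → EuclideanSpace ℂ (Fin m)) : 0 ≤ normSqProj a v := by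
  unfold normSqProj; positivity

/-- `normSqProj ≤ 1`. [folklore] -/
theorem normSqProj_le_one (a : Fin m) (v : Fin k → EuclideanSpace ℂ (Fin m)) : normSqProj a v ≤ 1 := by
  unfold normSqProj
  have h := norm_starProjection_le (span ℂ (Set.range v)) (EuclideanSpace.single a (1:ℂ))
  have he : ‖EuclideanSpace.single a (1:ℂ)‖ = 1 := (EuclideanSpace.orthonormal_single (𝕜 := ℂ)).1 a
  rw [he, one_pow] at h
  exact h

/-- The residual `P_{(span v)ᗮ} z` is the last Gram–Schmidt vector of the family `(v, z)`; in
particular it is measurable in `v`. [folklore] -/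
theorem starProjection_orthogonal_span_eq_gramSchmidt (v : Fin k → EuclideanSpace ℂ (Fin m))
    (z : EuclideanSpace ℂ (Fin m)) :
    (span ℂ (Set.range v))ᗮ.starProjection z =
      gramSchmidt ℂ (Fin.snoc v z : Fin (k + 1) → EuclideanSpace ℂ (Fin m)) (Fin.last k) := by
  have hset : (Fin.snoc v z : Fin (k + 1) → EuclideanSpace ℂ (Fin m)) '' Set.Iio (Fin.last k) = Set.range v := by
    ext w
    simp only [Set.mem_range, Set.mem_image, Set.mem_Iio]
    constructor
    · rintro ⟨i, hi, rfl⟩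
      have hi' : (i : ℕ) < k := hi
      refine ⟨⟨i, hi'⟩, ?_⟩
      have h := Fin.snoc_castSucc (α := fun _ => EuclideanSpace ℂ (Fin m)) z v ⟨i, hi'⟩
      have : Fin.castSucc ⟨i, hi'⟩ = i := Fin.ext rfl
      rw [this] at h
      exact h.symm
    · rintro ⟨j, rfl⟩
      exact ⟨Fin.castSucc j, Fin.castSucc_lt_last j, Fin.snoc_castSucc _ _ j⟩
  rw [gramSchmidt_eq_starProjection, Fin.snoc_last]
  simp only [hset]

/-- `normSqProj a v = 1 − ‖gramSchmidt (v, e_a)_{last}‖²` (Pythagoras). [folklore] -/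
theorem normSqProj_eq (a : Fin m) (v : Fin k → EuclideanSpace ℂ (Fin m)) :
    normSqProj a v = 1 - ‖gramSchmidt ℂ (Fin.snoc v (EuclideanSpace.single a (1:ℂ)) :
      Fin (k + 1) → EuclideanSpace ℂ (Fin m)) (Fin.last k)‖ ^ 2 := by
  rw [← starProjection_orthogonal_span_eq_gramSchmidt, normSqProj]
  have h := Submodule.norm_sq_eq_add_norm_sq_projection (EuclideanSpace.single a (1:ℂ)) (span ℂ (Set.range v))
  rw [Submodule.coe_norm, Submodule.coe_norm, ← starProjection_apply, ← starProjection_apply] at h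
  have he : ‖EuclideanSpace.single a (1:ℂ)‖ = 1 := (EuclideanSpace.orthonormal_single (𝕜 := ℂ)).1 a
  rw [he, one_pow] at h
  linarith

/-- `v ↦ normSqProj a v` is measurable. [folklore] -/
theorem measurable_normSqProj (a : Fin m) : Measurable (normSqProj (k := k) a) := by
  have : normSqProj (k := k) a = fun v => 1 - ‖gramSchmidt ℂ (Fin.snoc v (EuclideanSpace.single a (1:ℂ)) :
      Fin (k + 1) → EuclideanSpace ℂ (Fin m)) (Fin.last k)‖ ^ 2 := funext (normSqProj_eq a)
  rw [this]
  refine measurable_const.sub ((Measurable.norm ?_).pow_const 2)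
  have hsnoc : Measurable fun v : Fin k → EuclideanSpace ℂ (Fin m) =>
      (Fin.snoc v (EuclideanSpace.single a (1:ℂ)) : Fin (k + 1) → EuclideanSpace ℂ (Fin m)) := by
    refine measurable_pi_lambda _ fun i => ?_
    refine Fin.lastCases ?_ (fun j => ?_) i
    · simp only [Fin.snoc_last]; exact measurable_const
    · simp only [Fin.snoc_castSucc]; exact measurable_pi_apply j
  exact (measurable_gramSchmidt_apply ℂ (Fin.last k)).comp hsnoc

/-- **`∑_a ‖P_V e_a‖² = dim V ≤ k`** for `V` spanned by `k` vectors (Parseval for an orthonormal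
basis of `V`). [folklore] -/
theorem sum_normSqProj_le (v : Fin k → EuclideanSpace ℂ (Fin m)) : ∑ a, normSqProj a v ≤ k := by
  set V := span ℂ (Set.range v) with hV
  set c := stdOrthonormalBasis ℂ V
  have h1 : ∀ a, normSqProj a v = ∑ l, ‖(c l : EuclideanSpace ℂ (Fin m)) a‖ ^ 2 := by
    intro a
    change ‖V.starProjection (EuclideanSpace.single a (1:ℂ))‖ ^ 2 = _
    rw [norm_sq_starProjection_eq_sum c]
    refine Finset.sum_congr rfl fun l _ => ?_
    rw [EuclideanSpace.inner_single_right, one_mul, Complex.norm_conj]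
  simp_rw [h1]
  rw [Finset.sum_comm]
  have h2 : ∀ l, ∑ a, ‖(c l : EuclideanSpace ℂ (Fin m)) a‖ ^ 2 = 1 := by
    intro l
    rw [← EuclideanSpace.norm_sq_eq, ← Submodule.coe_norm, c.orthonormal.1 l, one_pow]
  simp_rw [h2]
  rw [Finset.sum_const, Finset.card_univ, Fintype.card_fin, nsmul_eq_mul, mul_one]
  have h3 : finrank ℂ V ≤ k := by
    have := finrank_range_le_card (R := ℂ) v
    rw [Fintype.card_fin] at this
    exact this
  exact_mod_cast h3

/-- Equivariance under coordinate permutations: `‖P_{σV} e_a‖ = ‖P_V e_{σ⁻¹a}‖`. [folklore] -/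
theorem normSqProj_comp_piLpCongrLeft (σ : Equiv.Perm (Fin m)) (a : Fin m) (v : Fin k → EuclideanSpace ℂ (Fin m)) :
    normSqProj a (fun j => LinearIsometryEquiv.piLpCongrLeft 2 ℂ ℂ σ (v j)) = normSqProj (σ.symm a) v := by
  set L := LinearIsometryEquiv.piLpCongrLeft 2 ℂ ℂ σ with hL
  have hspan : span ℂ (Set.range fun j => L (v j)) = (span ℂ (Set.range v)).map (L.toLinearEquiv : EuclideanSpace ℂ (Fin m) →ₗ[ℂ] EuclideanSpace ℂ (Fin m)) := by
    rw [Submodule.map_span, ← Set.range_comp]; rfl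
  have hsingle : L.symm (EuclideanSpace.single a (1:ℂ)) = EuclideanSpace.single (σ.symm a) (1:ℂ) := by
    rw [hL, LinearIsometryEquiv.piLpCongrLeft_symm]
    exact LinearIsometryEquiv.piLpCongrLeft_single σ.symm a (1:ℂ)
  unfold normSqProj
  simp only [hspan, starProjection_map_apply, LinearIsometryEquiv.norm_map, hsingle]

end Proj

/-! ### The averaged bound -/

section Average

variable {n' k : ℕ}

/-- The columns law on `Fin n'` columns is invariant under a coordinate permutation applied to every
column. [folklore] -/
theorem ginibre_map_piLpCongrLeft (σ : Equiv.Perm (Fin m)) :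
    (ginibre m n').map (fun y j => LinearIsometryEquiv.piLpCongrLeft 2 ℂ ℂ σ (y j)) = ginibre m n' := by
  rw [ginibre, Measure.pi_map_pi (fun _ =>
    (LinearIsometryEquiv.piLpCongrLeft 2 ℂ ℂ σ).continuous.measurable.aemeasurable)]
  congr 1; funext j
  exact gaussianEuc_map_piLpCongrLeft σ

/-- **Averaged projection bound.** Let `cols y` pick `k` vectors out of the i.i.d. Gaussian columns
`y` measurably and equivariantly under coordinate permutations. Then
`∫ ∑_{i<n} ‖P_{span(cols y)} e_{castLE i}‖² dy ≤ n k/m` (every coordinate contributes at most `k/m`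
by symmetry, since `∑_{a<m} ‖P_V e_a‖² ≤ k`). [folklore] -/
theorem integral_sum_normSqProj_le (hle : n ≤ m) (cols : (Fin n' → EuclideanSpace ℂ (Fin m)) → Fin k → EuclideanSpace ℂ (Fin m))
    (hcols : Measurable cols)
    (hequiv : ∀ (σ : Equiv.Perm (Fin m)) (y : Fin n' → EuclideanSpace ℂ (Fin m)),
      cols (fun j => LinearIsometryEquiv.piLpCongrLeft 2 ℂ ℂ σ (y j)) =
        fun l => LinearIsometryEquiv.piLpCongrLeft 2 ℂ ℂ σ (cols y l)) :
    ∫ y, ∑ i : Fin n, normSqProj (Fin.castLE hle i) (cols y) ∂(ginibre m n') ≤ (n:ℝ) * k / m := by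
  set μ := ginibre m n' with hμ
  set I : Fin m → ℝ := fun a => ∫ y, normSqProj a (cols y) ∂μ with hI
  have hint : ∀ a, Integrable (fun y => normSqProj a (cols y)) μ := by
    intro a
    refine Integrable.of_bound ((measurable_normSqProj a).comp hcols).aestronglyMeasurable 1
      (Filter.Eventually.of_forall fun y => ?_)
    rw [Real.norm_eq_abs, abs_of_nonneg (normSqProj_nonneg _ _)]
    exact normSqProj_le_one _ _
  -- symmetry: all `I a` are equal
  have hsymm : ∀ a a', I a = I a' := by
    intro a a'
    set σ : Equiv.Perm (Fin m) := Equiv.swap a a' with hσ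
    have hmeas : Measurable fun (y : Fin n' → EuclideanSpace ℂ (Fin m)) (j : Fin n') =>
        LinearIsometryEquiv.piLpCongrLeft 2 ℂ ℂ σ (y j) :=
      measurable_pi_lambda _ fun j =>
        (LinearIsometryEquiv.piLpCongrLeft 2 ℂ ℂ σ).continuous.measurable.comp (measurable_pi_apply j)
    calc I a = ∫ y, normSqProj a (cols y) ∂(μ.map fun y j => LinearIsometryEquiv.piLpCongrLeft 2 ℂ ℂ σ (y j)) := by
          rw [hμ, ginibre_map_piLpCongrLeft]
      _ = ∫ y, normSqProj a (cols fun j => LinearIsometryEquiv.piLpCongrLeft 2 ℂ ℂ σ (y j)) ∂μ := by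
          rw [integral_map hmeas.aemeasurable]
          exact ((measurable_normSqProj a).comp hcols).aestronglyMeasurable
      _ = ∫ y, normSqProj (σ.symm a) (cols y) ∂μ := by
          refine integral_congr_ae (Filter.Eventually.of_forall fun y => ?_)
          simp only
          rw [hequiv, normSqProj_comp_piLpCongrLeft]
      _ = I a' := by
          simp only [hI, hσ, Equiv.symm_swap, Equiv.swap_apply_left]
  -- the sum over all coordinates is at most `k`
  have hsum : ∑ a, I a ≤ k := by
    calc ∑ a, I a = ∫ y, ∑ a, normSqProj a (cols y) ∂μ := by
          rw [integral_finsetSum _ fun a _ => hint a]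
      _ ≤ ∫ _y, (k:ℝ) ∂μ := by
          refine integral_mono (integrable_finsetSum _ fun a _ => hint a) (integrable_const _)
            fun y => sum_normSqProj_le (cols y)
      _ = k := by simp
  -- conclude
  have hm : ∀ a, (m:ℝ) * I a ≤ k := by
    intro a
    calc (m:ℝ) * I a = ∑ _a' : Fin m, I a := by simp
      _ = ∑ a', I a' := Finset.sum_congr rfl fun a' _ => hsymm a a'
      _ ≤ k := hsum
  rcases Nat.eq_zero_or_pos m with hm0 | hm0
  · subst hm0
    have hn0 : n = 0 := Nat.le_zero.1 hle
    subst hn0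
    simp
  · have hmR : (0:ℝ) < m := by exact_mod_cast hm0
    rw [integral_finsetSum _ fun i _ => hint _]
    calc ∑ i : Fin n, I (Fin.castLE hle i) ≤ ∑ _i : Fin n, (k:ℝ) / m :=
          Finset.sum_le_sum fun i _ => by
            rw [le_div_iff₀ hmR, mul_comm]; exact hm _
      _ = (n:ℝ) * k / m := by
          rw [Finset.sum_const, Finset.card_univ, Fintype.card_fin, nsmul_eq_mul]; ring

end Average

end Literature.Probability.RandomMatrix
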